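import Summits.Ventures.Crystal3D.Theorems.StickyWulffConstantGenericWallFloorBarlowFamilyCountOneSidedTiltWide
import Summits.Ventures.Crystal3D.Theorems.StickyWulffConstantGenericWallFloorBarlowTopFamilyApartTiltWide
import HarnessLib

/-!
# TWO steered zigzag families are paid TOGETHER, WIDE tilt 1/3: `#T₁ + #T₂ ≤ Σ_PAY (12 − deg)` (EDGE-ON option (ε₂), brick 1 = G1)
# (lane T crux `TextureLiminfV5`, stmt-Ventures-23912, sub-crux EDGE-ON `stub_edgeOn`; cf-p1 Q-ε₂ (cxvii)(2), answered 2026-08-29 by 19480-p2 g12)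

HONEST FRAMING. Venture `Summits/Ventures/Crystal3D` (cell `crystal3d-full`), route `route-Ventures-StickyWulffConstant`, helper `--supports` the
law-v5 crux `TextureLiminfV5` (stmt-Ventures-23912), registered line `TexShadow` v8.5, open stub `stub_edgeOn` (K4).  Rung credit only; F-C1 not moved; NOT
the stub.  Inputs BY NAME: E1 (`hsE`, `hcert`), `DoubleStarCoaxialAt` / `CapPairCoaxial` (from `StarPairFar`).

THE POINT (the «additivity device» of Q-ε₂ is lane G's existing STATE-ADDITIVE ledger).  The one-sided steered counts
`barlowFamily_card_le_payers_oneSided_tiltWide` (bottom plate, steering `z₁`, ‖z₁ − e₃‖ ≤ 1/3) and `…_oneSided_top_tiltWide` (top plate, steering `z₂`,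
‖z₂ + e₃‖ ≤ 1/3) each feed ONE family spec (`bottomFamily_spec_apart_tiltWide` / `topFamily_spec_apart_tiltWide`) to the frame-separated two-family ledger
`walkerFamilies_card_le_payers_sep` with an EMPTY partner.  This file feeds BOTH specs to the SAME call: per payer ball `y` the ledger's local count
`deg y + #ES₁(y) + #ES₂(y) ≤ 12` adds the two families' end STATES at `y` (two end states at one ball, one per family, are different walker states with
non-coaxial top frames), so the payer window pays both streams at once — provided the two chain-frame sets are separated:
* clause (i)  `hapart₁` — no frame of `chainFrames z₁ L₁ v₁` carries plate 2's bilayer lattice `L₂·Λ₀` or its basal twin's (family 1 is sealed below plate 2);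
* clause (ii) `hapart₂` — the same for `chainFrames z₂ L₂ v₂` against plate 1;
* clause (iii)_z `hsep` — no frame of `chainFrames z₁ L₁ v₁` is Barlow-coaxial with a frame of `chainFrames z₂ L₂ v₂` (the two bottom entries then differ,
  exactly as in the unsteered `barlowFamilies_card_le_payers_apart`).
* **`barlowFamilies_card_le_payers_apart_tiltWide`** — `#T₁ + #T₂ ≤ Σ_{y ∈ PAY} (12 − deg y)`, PAY = lane T's window `deg ≠ 12 ∧ −R₀ − 2 ≤ y₂ ≤ h + R₀ + 2`, one common
  fuel `N` (the three fuel hypotheses of each one-sided file).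
WHAT THIS IS NOT: not the window LINES (next file, G2), not lane T's `hlines` shape (G3), not the stub; the EDGE-ON corner (no up-slot of e₃-rise ≥ 0.4354 on
a plate) has no family at all and is untouched; F-C1 not moved.
-/

noncomputable section

namespace Summit.Ventures.Crystal3D.Theorems

open Finset
open Literature.MathematicalPhysics.StatisticalMechanics
open Summit.Ventures.Crystal3D.Cruxes.TextureLiminf.TexShadow (stacking)
open scoped InnerProductSpace

variable {X : Finset (EuclideanSpace ℝ (Fin 3))}

open scoped Classical in
/-- **TWO steered Barlow zigzag families are paid by the payers, under frame separation (i), (ii), (iii)_z**, wide tilt `1/3`: the bottom plate's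
window family walks along `z₁` (‖z₁ − e₃‖ ≤ 1/3, launch slot `v₁` steep for `z₁`, `∇`-cappers `bestCapper G₁ (L₁ e₃) z₁`), the top plate's along `z₂`
(‖z₂ + e₃‖ ≤ 1/3, launch slot `v₂` steep for `z₂`, `∇`-cappers `bestCapper G₂ (L₂ e₃) z₂`); then `#T₁ + #T₂ ≤ Σ_PAY (12 − deg)`. -/
theorem barlowFamilies_card_le_payers_apart_tiltWide (hX : ∀ p ∈ X, ∀ q ∈ X, p ≠ q → 1 ≤ dist p q)
    {sE : EuclideanSpace ℝ (Fin 3)} (hsE : sE ∈ fccSlots) (hcert : ExactOnly 0 (fccSlots.filter fun w => 0 < ⟪w, sE⟫_ℝ))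
    (hDS : ∀ F₁ F₂ : EuclideanSpace ℝ (Fin 3) ≃ₗᵢ[ℝ] EuclideanSpace ℝ (Fin 3), DoubleStarCoaxialAt F₁ F₂) (hCP : CapPairCoaxial)
    -- the cell
    {σ₁ σ₂ : ℤ → ℤ} (hσ₁ : IsHaggSeq σ₁) (hσ₂ : IsHaggSeq σ₂)
    (L₁ L₂ : EuclideanSpace ℝ (Fin 3) ≃ₗᵢ[ℝ] EuclideanSpace ℝ (Fin 3)) (s₀ s₂ : EuclideanSpace ℝ (Fin 3))
    (R₀ h ρ : ℝ) (hR₀ : 6 ≤ R₀) (hh : 0 ≤ h) (hρ : 1 ≤ ρ) (P₁ P₂ : Finset (EuclideanSpace ℝ (Fin 3))) (hP₁X : P₁ ⊆ X) (hP₂X : P₂ ⊆ X)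
    (hcell : ∀ p ∈ X, -(2 * R₀) ≤ p 2 ∧ p 2 ≤ h + 2 * R₀ ∧ p 0 ^ 2 + p 1 ^ 2 ≤ ρ ^ 2)
    (hP₁ : ∀ p, p ∈ P₁ ↔ (p ∈ stacking L₁ s₀ σ₁ ∧ -(2 * R₀) ≤ p 2 ∧ p 2 ≤ -R₀ ∧ p 0 ^ 2 + p 1 ^ 2 ≤ ρ ^ 2))
    (hP₂ : ∀ p, p ∈ P₂ ↔ (p ∈ stacking L₂ s₂ σ₂ ∧ h + R₀ ≤ p 2 ∧ p 2 ≤ h + 2 * R₀ ∧ p 0 ^ 2 + p 1 ^ 2 ≤ ρ ^ 2))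
    -- the bottom steering and walk data (window heights along e₃)
    {z₁ : EuclideanSpace ℝ (Fin 3)} (hz₁ : ‖z₁‖ = 1) (hz₁e : ‖z₁ - EuclideanSpace.single (2 : Fin 3) (1 : ℝ)‖ ≤ 1 / 3)
    (v₁ : EuclideanSpace ℝ (Fin 3)) (canon₁ : ℤ → EuclideanSpace ℝ (Fin 3) → EuclideanSpace ℝ (Fin 3) × List WalkEntry)
    (ms₁ : ℤ → EuclideanSpace ℝ (Fin 3))
    (hv₁ : v₁ ∈ fccSlots) (hv₁2 : v₁ 2 = Real.sqrt (2 / 3))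
    (hsteep₁ : Real.sqrt 2 / 2 ≤ ⟪L₁ v₁, z₁⟫_ℝ)
    (hcanon₁₁ : ∀ m t, σ₁ (m - 1) = 1 → canon₁ m t = (t, [⟨L₁, v₁, 0⟩]))
    (hcanon₁₂ : ∀ m t, σ₁ (m - 1) = -1 → canon₁ m t =
      (t, [⟨twinFrame L₁ (L₁ (EuclideanSpace.single (2 : Fin 3) (1 : ℝ))),
            bestCapper (twinFrame L₁ (L₁ (EuclideanSpace.single (2 : Fin 3) (1 : ℝ)))) (L₁ (EuclideanSpace.single (2 : Fin 3) (1 : ℝ))) z₁,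
            L₁ (EuclideanSpace.single (2 : Fin 3) (1 : ℝ))⟩, ⟨L₁, v₁, 0⟩]))
    (hms₁₁ : ∀ m, σ₁ m = 1 → ms₁ m = v₁)
    (hms₁₂ : ∀ m, σ₁ m = -1 → ms₁ m =
      basalMirror (bestCapper (twinFrame L₁ (L₁ (EuclideanSpace.single (2 : Fin 3) (1 : ℝ)))) (L₁ (EuclideanSpace.single (2 : Fin 3) (1 : ℝ))) z₁))
    {δ₁ : ℝ} (hδ₁0 : 0 < δ₁) (hδ₁ : ∀ m, δ₁ ≤ ⟪L₁ (ms₁ m), EuclideanSpace.single (2 : Fin 3) (1 : ℝ)⟫_ℝ)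
    -- the top steering and walk data (window heights along −e₃)
    {z₂ : EuclideanSpace ℝ (Fin 3)} (hz₂ : ‖z₂‖ = 1) (hz₂e : ‖z₂ - (-EuclideanSpace.single (2 : Fin 3) (1 : ℝ))‖ ≤ 1 / 3)
    (v₂ : EuclideanSpace ℝ (Fin 3)) (canon₂ : ℤ → EuclideanSpace ℝ (Fin 3) → EuclideanSpace ℝ (Fin 3) × List WalkEntry)
    (ms₂ : ℤ → EuclideanSpace ℝ (Fin 3))
    (hv₂ : v₂ ∈ fccSlots) (hv₂2 : v₂ 2 = Real.sqrt (2 / 3))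
    (hsteep₂ : Real.sqrt 2 / 2 ≤ ⟪L₂ v₂, z₂⟫_ℝ)
    (hcanon₂₁ : ∀ m t, σ₂ (m - 1) = 1 → canon₂ m t = (t, [⟨L₂, v₂, 0⟩]))
    (hcanon₂₂ : ∀ m t, σ₂ (m - 1) = -1 → canon₂ m t =
      (t, [⟨twinFrame L₂ (L₂ (EuclideanSpace.single (2 : Fin 3) (1 : ℝ))),
            bestCapper (twinFrame L₂ (L₂ (EuclideanSpace.single (2 : Fin 3) (1 : ℝ)))) (L₂ (EuclideanSpace.single (2 : Fin 3) (1 : ℝ))) z₂,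
            L₂ (EuclideanSpace.single (2 : Fin 3) (1 : ℝ))⟩, ⟨L₂, v₂, 0⟩]))
    (hms₂₁ : ∀ m, σ₂ m = 1 → ms₂ m = v₂)
    (hms₂₂ : ∀ m, σ₂ m = -1 → ms₂ m =
      basalMirror (bestCapper (twinFrame L₂ (L₂ (EuclideanSpace.single (2 : Fin 3) (1 : ℝ)))) (L₂ (EuclideanSpace.single (2 : Fin 3) (1 : ℝ))) z₂))
    {δ₂ : ℝ} (hδ₂0 : 0 < δ₂) (hδ₂ : ∀ m, δ₂ ≤ ⟪L₂ (ms₂ m), -EuclideanSpace.single (2 : Fin 3) (1 : ℝ)⟫_ℝ)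
    -- frames apart: clauses (i), (ii) and the steered pair clause (iii)_z
    (hapart₁ : ∀ F ∈ chainFrames z₁ L₁ v₁,
      F '' fccStacking 1 (Real.sqrt (2 / 3)) ≠ L₂ '' fccStacking 1 (Real.sqrt (2 / 3)) ∧
      F '' fccStacking 1 (Real.sqrt (2 / 3)) ≠
        (twinFrame L₂ (L₂ (EuclideanSpace.single (2 : Fin 3) (1 : ℝ)))) '' fccStacking 1 (Real.sqrt (2 / 3)))
    (hapart₂ : ∀ F ∈ chainFrames z₂ L₂ v₂,
      F '' fccStacking 1 (Real.sqrt (2 / 3)) ≠ L₁ '' fccStacking 1 (Real.sqrt (2 / 3)) ∧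
      F '' fccStacking 1 (Real.sqrt (2 / 3)) ≠
        (twinFrame L₁ (L₁ (EuclideanSpace.single (2 : Fin 3) (1 : ℝ)))) '' fccStacking 1 (Real.sqrt (2 / 3)))
    (hsep : ∀ F₁ ∈ chainFrames z₁ L₁ v₁, ∀ F₂ ∈ chainFrames z₂ L₂ v₂,
      ¬ ∃ (L : EuclideanSpace ℝ (Fin 3) ≃ₗᵢ[ℝ] EuclideanSpace ℝ (Fin 3)) (t₁ t₂ : EuclideanSpace ℝ (Fin 3)) (σ σ' : ℤ → ℤ),
        IsHaggSeq σ ∧ IsHaggSeq σ' ∧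
        F₁ '' fccStacking 1 (Real.sqrt (2 / 3)) ⊆ (fun p => L p + t₁) '' barlowStacking 1 (Real.sqrt (2 / 3)) σ ∧
        F₂ '' fccStacking 1 (Real.sqrt (2 / 3)) ⊆ (fun p => L p + t₂) '' barlowStacking 1 (Real.sqrt (2 / 3)) σ')
    -- the two window families
    (H₁ H₂ ρin : ℝ) (hH₁lo : -(2 * R₀) + 2 ≤ H₁) (hH₁hi : H₁ ≤ -R₀ - 3) (hH₂lo : -(h + 2 * R₀) + 2 ≤ H₂) (hH₂hi : H₂ ≤ -(h + R₀) - 3)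
    (hρin₁ : ρin + 24 * (h + 4 * R₀) + ((-R₀ - 2 - H₁) / δ₁ + 2) ≤ ρ - 1)
    (hρin₂ : ρin + 24 * (h + 4 * R₀) + ((-(h + R₀) - 2 - H₂) / δ₂ + 2) ≤ ρ - 1)
    {ι₁ ι₂ : Type*} (T₁ : Finset ι₁) (T₂ : Finset ι₂) (m₁ a₁ b₁ : ι₁ → ℤ) (m₂ a₂ b₂ : ι₂ → ℤ)
    (hlow₁ : ∀ i ∈ T₁, H₁ ≤ ⟪L₁ (barlowPos 1 (Real.sqrt (2 / 3)) σ₁ (m₁ i) (a₁ i) (b₁ i)) + s₀, EuclideanSpace.single (2 : Fin 3) (1 : ℝ)⟫_ℝ)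
    (hpred₁ : ∀ i ∈ T₁, ⟪L₁ (barlowPos 1 (Real.sqrt (2 / 3)) σ₁ (m₁ i) (a₁ i) (b₁ i) - ms₁ (m₁ i - 1)) + s₀,
      EuclideanSpace.single (2 : Fin 3) (1 : ℝ)⟫_ℝ < H₁)
    (hinjT₁ : ∀ i ∈ T₁, ∀ j ∈ T₁,
      barlowPos 1 (Real.sqrt (2 / 3)) σ₁ (m₁ i) (a₁ i) (b₁ i) = barlowPos 1 (Real.sqrt (2 / 3)) σ₁ (m₁ j) (a₁ j) (b₁ j) → i = j)
    (hlat₁ : ∀ i ∈ T₁, Real.sqrt ((L₁ (barlowPos 1 (Real.sqrt (2 / 3)) σ₁ (m₁ i) (a₁ i) (b₁ i)) + s₀) 0 ^ 2 +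
      (L₁ (barlowPos 1 (Real.sqrt (2 / 3)) σ₁ (m₁ i) (a₁ i) (b₁ i)) + s₀) 1 ^ 2) ≤ ρin)
    (hlow₂ : ∀ i ∈ T₂, H₂ ≤ ⟪L₂ (barlowPos 1 (Real.sqrt (2 / 3)) σ₂ (m₂ i) (a₂ i) (b₂ i)) + s₂, -EuclideanSpace.single (2 : Fin 3) (1 : ℝ)⟫_ℝ)
    (hpred₂ : ∀ i ∈ T₂, ⟪L₂ (barlowPos 1 (Real.sqrt (2 / 3)) σ₂ (m₂ i) (a₂ i) (b₂ i) - ms₂ (m₂ i - 1)) + s₂,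
      -EuclideanSpace.single (2 : Fin 3) (1 : ℝ)⟫_ℝ < H₂)
    (hinjT₂ : ∀ i ∈ T₂, ∀ j ∈ T₂,
      barlowPos 1 (Real.sqrt (2 / 3)) σ₂ (m₂ i) (a₂ i) (b₂ i) = barlowPos 1 (Real.sqrt (2 / 3)) σ₂ (m₂ j) (a₂ j) (b₂ j) → i = j)
    (hlat₂ : ∀ i ∈ T₂, Real.sqrt ((L₂ (barlowPos 1 (Real.sqrt (2 / 3)) σ₂ (m₂ i) (a₂ i) (b₂ i)) + s₂) 0 ^ 2 +
      (L₂ (barlowPos 1 (Real.sqrt (2 / 3)) σ₂ (m₂ i) (a₂ i) (b₂ i)) + s₂) 1 ^ 2) ≤ ρin)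
    -- fuel (one common `N`)
    {N : ℕ} (hN₁ : ⌈(-R₀ - 2 - H₁) / δ₁⌉₊ + 1 ≤ N) (hN₂ : ⌈(-(h + R₀) - 2 - H₂) / δ₂⌉₊ + 1 ≤ N) (hN : 24 * (h + 4 * R₀) < (N : ℝ))
    (hN₃ : 8 * (h + 4 * R₀) + 6 * (ρ + h + 2 * R₀) < 3 * (N : ℝ)) :
    (T₁.card : ℝ) + T₂.card ≤
      ∑ y ∈ X.filter (fun y => (X.filter fun q => dist y q = 1).card ≠ 12 ∧ -R₀ - 2 ≤ y 2 ∧ y 2 ≤ h + R₀ + 2),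
        ((12 : ℝ) - ((X.filter fun q => dist y q = 1).card : ℝ)) := by
  set e₃ : EuclideanSpace ℝ (Fin 3) := EuclideanSpace.single (2 : Fin 3) (1 : ℝ) with he₃
  have he₃n : ‖e₃‖ = 1 := by rw [he₃, PiLp.norm_single, norm_one]
  have he₃i : ∀ d : EuclideanSpace ℝ (Fin 3), ⟪d, e₃⟫_ℝ = d 2 := fun d => by rw [he₃, EuclideanSpace.inner_single_right]; simp
  have hzti : ∀ d : EuclideanSpace ℝ (Fin 3), ⟪d, -e₃⟫_ℝ = -d 2 := fun d => by rw [inner_neg_right, he₃i]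
  -- the two family specs (validity, well-formedness, bottom entry, strong certificate, end in PAY; injectivity)
  obtain ⟨hB, hinjB⟩ := bottomFamily_spec_apart_tiltWide σ₁ L₁ s₀ z₁ v₁ canon₁ ms₁ hσ₁ hX hsE hcert hσ₂ L₂ s₂ R₀ h ρ hR₀ hh hρ P₁ P₂ hP₁X hP₂X
    hcell hP₁ hP₂ hz₁ hz₁e hv₁ hv₁2 hsteep₁ hcanon₁₁ hcanon₁₂ hms₁₁ hms₁₂ hδ₁0 hδ₁ hapart₁ H₁ ρin hH₁lo hH₁hi hρin₁ T₁ m₁ a₁ b₁ hlow₁ hpred₁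
    hinjT₁ hlat₁ hN₁ hN
  obtain ⟨hT, hinjT⟩ := topFamily_spec_apart_tiltWide σ₂ L₂ s₂ v₂ canon₂ ms₂ hσ₂ hX hsE hcert hσ₁ L₁ s₀ R₀ h ρ hR₀ hh hρ P₁ P₂ hP₁X hP₂X hcell
    hP₁ hP₂ hz₂ hz₂e hv₂ hv₂2 hsteep₂ hcanon₂₁ hcanon₂₂ hms₂₁ hms₂₂ hδ₂0 hδ₂ hapart₂ H₂ ρin hH₂lo hH₂hi hρin₂ T₂ m₂ a₂ b₂ hlow₂ hpred₂ hinjT₂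
    hlat₂ hN₂ hN
  set st₁ : ι₁ → EuclideanSpace ℝ (Fin 3) × List WalkEntry :=
    fun i => canon₁ (m₁ i) (L₁ (barlowPos 1 (Real.sqrt (2 / 3)) σ₁ (m₁ i) (a₁ i) (b₁ i)) + s₀) with hst₁
  set st₂ : ι₂ → EuclideanSpace ℝ (Fin 3) × List WalkEntry :=
    fun i => canon₂ (m₂ i) (L₂ (barlowPos 1 (Real.sqrt (2 / 3)) σ₂ (m₂ i) (a₂ i) (b₂ i)) + s₂) with hst₂
  -- the `zᵢ`-height bounds of the cell and the per-start fuel (tilt transfer `⟪q, zᵢ⟫ ≤ ±q₂ + ‖q‖/3`)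
  have hnorm : ∀ q ∈ X, ‖q‖ ≤ ρ + h + 2 * R₀ := fun q hq =>
    norm_le_of_mem_cyl (by linarith) hh (by linarith) (hcell q hq)
  set Hz₁ : ℝ := h + 2 * R₀ + (ρ + h + 2 * R₀) / 3 with hHz₁
  set Hz₂ : ℝ := 2 * R₀ + (ρ + h + 2 * R₀) / 3 with hHz₂
  have hez₁ : ‖e₃ - z₁‖ ≤ 1 / 3 := by rw [norm_sub_rev]; exact hz₁e
  have hez₂ : ‖-e₃ - z₂‖ ≤ 1 / 3 := by rw [norm_sub_rev]; exact hz₂e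
  have hH₁ : ∀ q ∈ X, ⟪q, z₁⟫_ℝ ≤ Hz₁ := by
    intro q hq
    have h1 := inner_ref_ge_of_tilt_wide hz₁e q
    rw [he₃i] at h1
    have h2 := (hcell q hq).2.1
    have h3 := hnorm q hq
    rw [hHz₁]; linarith
  have hfuel₁ : ∀ q ∈ X, 8 * (Hz₁ - ⟪q, z₁⟫_ℝ) < 3 * N := by
    intro q hq
    have h1 := inner_ref_ge_of_tilt_wide hez₁ q
    rw [he₃i] at h1
    have h2 := (hcell q hq).1
    have h3 := hnorm q hq
    rw [hHz₁]; linarith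
  have hH₂ : ∀ q ∈ X, ⟪q, z₂⟫_ℝ ≤ Hz₂ := by
    intro q hq
    have h1 := inner_ref_ge_of_tilt_wide hz₂e q
    rw [hzti] at h1
    have h2 := (hcell q hq).1
    have h3 := hnorm q hq
    rw [hHz₂]; linarith
  have hfuel₂ : ∀ q ∈ X, 8 * (Hz₂ - ⟪q, z₂⟫_ℝ) < 3 * N := by
    intro q hq
    have h1 := inner_ref_ge_of_tilt_wide hez₂ q
    rw [hzti] at h1
    have h2 := (hcell q hq).2.1
    have h3 := hnorm q hq
    rw [hHz₂]; linarith
  -- the frame invariants of the two bottom entries, and distinct bottoms (from (iii)_z: `L₁ = L₂` would be coaxial with itself)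
  have hM₁ : ∀ stk : List WalkEntry, StackSound z₁ stk → StackWF z₁ stk → stk.getLast? = some ⟨L₁, v₁, 0⟩ →
      ∀ e ∈ stk, e.frame ∈ chainFrames z₁ L₁ v₁ := fun stk hS hWF hl => frame_mem_chainFrames_of_stack hS hWF hl
  have hM₂ : ∀ stk : List WalkEntry, StackSound z₂ stk → StackWF z₂ stk → stk.getLast? = some ⟨L₂, v₂, 0⟩ →
      ∀ e ∈ stk, e.frame ∈ chainFrames z₂ L₂ v₂ := fun stk hS hWF hl => frame_mem_chainFrames_of_stack hS hWF hl
  have hbb : (⟨L₁, v₁, 0⟩ : WalkEntry) ≠ ⟨L₂, v₂, 0⟩ := by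
    intro hb
    have hL : L₁ = L₂ := congrArg WalkEntry.frame hb
    refine hsep L₁ (self_mem_chainFrames z₁ L₁ v₁) L₂ (self_mem_chainFrames z₂ L₂ v₂)
      ⟨L₁, 0, 0, constHagg, constHagg, isHaggSeq_const, isHaggSeq_const, ?_, ?_⟩
    · rintro _ ⟨p, hp, rfl⟩; exact ⟨p, hp, by simp⟩
    · rw [← hL]; rintro _ ⟨p, hp, rfl⟩; exact ⟨p, hp, by simp⟩
  -- THE COUNT: both families in ONE call of the frame-separated ledger
  refine walkerFamilies_card_le_payers_sep hX hsE hcert hDS hCP (chainFrames z₁ L₁ v₁) (chainFrames z₂ L₂ v₂) hsep hz₁ hz₂ hH₁ hH₂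
    T₁ T₂ st₁ st₂ hbb N hM₁ hM₂ (fun t ht => ?_) (fun t ht => ?_) hinjB hinjT _ (fun t ht => (hB t ht).2.2.2.2)
    (fun t ht => (hT t ht).2.2.2.2)
  · obtain ⟨hI, hW, hl, hC, -⟩ := hB t ht
    exact ⟨hI, hW, hl, hC, hfuel₁ _ hI.1⟩
  · obtain ⟨hI, hW, hl, hC, -⟩ := hT t ht
    exact ⟨hI, hW, hl, hC, hfuel₂ _ hI.1⟩

end Summit.Ventures.Crystal3D.Theorems

end
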